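import Mathlib
import HarnessLib
import Summits.AnomalousDissipation.AnomalousDissipation.Theses.DecimationAxis
import Literature.Analysis.FluidPDE.GalerkinFlow
import Literature.Analysis.FluidPDE.LongTimeAverageShift
import Literature.Analysis.FluidPDE.LerayHopfGalileanTorusMeans

/-!
# Stub-ideation k=2 (home family RESHAPE) — helper-lemma signatures for `stub_absorbedWitness`
(crux `DecimationAxis.UniformEquilibration`, item stmt-AnomalousDissipation-1583, skeleton
`Cruxes/UniformEquilibration/Lines/birth.lean`). Companion of `STUB-IDEAS-stub_absorbedWitness-2.md`.

Elaboration sanity only (planner seat, no proving): the ten helpers H0–H9 are `sorry`;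
`resolvedDissipation_nonneg/le` and the assembly `stub_absorbedWitness_of_planA :
Sig.stub_absorbedWitness` are REAL proofs modulo H0, H2, H4, H6 (so Plan A's bookkeeping —
`B` chosen before `E ε M K S`, witness = time shift by `s = log (1 + e₀)/(4π²ν)` — is kernel-checked).
`lean check` rc 0, sorries = 10 = helpers. §0 is a verbatim copy of the skeleton's vocabulary in a
separate namespace (`…StubIdeas2`), so nothing here collides with or imports `Lines/birth.lean`.
-/

set_option linter.dupNamespace false

noncomputable section

namespace Summit.AnomalousDissipation.AnomalousDissipation.Cruxes.UniformEquilibration.StubIdeas2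

open scoped BigOperators Topology Classical MeasureTheory InnerProductSpace ComplexConjugate
open Filter Set Function MeasureTheory
open Literature.Analysis.FunctionSpaces Literature.Analysis.FunctionSpaces.Torus
open Literature.Analysis.FluidPDE
open Summit.AnomalousDissipation.AnomalousDissipation.Theses.DecimationAxis

local notation "ℤ³" => Fin 3 → ℤ
local notation "ℂ³" => EuclideanSpace ℂ (Fin 3)

/-! ### §0 Vocabulary (verbatim copy of `Lines/birth.lean` §0–§1, stub 1 only) -/

def IsCoeffTrajectory (S : Finset ℤ³) (ν : ℝ) (g : ℤ³ → ℂ³) (c : ℝ → ↥S → ℂ³) : Prop :=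
  (∀ t, c t ∈ galerkinSubspace S) ∧ ContinuousOn c (Set.Ici 0) ∧
    ∀ T : ℝ, ∀ t ∈ Set.Icc (0 : ℝ) T,
      HasDerivWithinAt c (galerkinRHS S ν (fun k => g k) (c t)) (Set.Icc 0 T) t

def modalEnergy {S : Finset ℤ³} (a : ↥S → ℂ³) : ℝ :=
  ∑ k : ↥S, ‖a k‖ ^ 2

def resolvedDissipation {S : Finset ℤ³} (ν : ℝ) (M : ℕ) (a : ↥S → ℂ³) : ℝ :=
  ν * (4 * Real.pi ^ 2 * ∑ k : ↥S,
    if freqNormSq (k : ℤ³) ≤ (M : ℝ) ^ 2 then freqNormSq (k : ℤ³) * ‖a k‖ ^ 2 else 0)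

def Sig.stub_absorbedWitness : Prop :=
  ∀ (ν : ℝ), 0 < ν → ∀ (N : ℕ) (g : ℤ³ → ℂ³), IsConjSymm g → (∀ k, k ∉ freqBall N → g k = 0) →
    g 0 = 0 → (∀ k : ℤ³, ∑ i, ((k i : ℤ) : ℂ) * g k i = 0) →
    ∃ B : ℝ, ∀ (E ε : ℝ) (M K : ℕ) (S : Finset ℤ³), S = (freqBall K).erase 0 →
      (∃ c : ℝ → ↥S → ℂ³, IsCoeffTrajectory S ν g c ∧
          longTimeAvgSup (fun t => modalEnergy (c t)) ≤ E ∧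
          2 * ε ≤ longTimeAvgInf (fun t => resolvedDissipation ν M (c t))) →
      ∃ c : ℝ → ↥S → ℂ³, IsCoeffTrajectory S ν g c ∧ (∀ t, 0 ≤ t → modalEnergy (c t) ≤ B) ∧
          longTimeAvgSup (fun t => modalEnergy (c t)) ≤ E ∧
          2 * ε ≤ longTimeAvgInf (fun t => resolvedDissipation ν M (c t))

/-! ### §1 PLAN A helpers (Gronwall normal form + liminf-by-duality) -/

/-- H0 (bookkeeping, XS): the punctured ball is symmetric. -/
theorem neg_mem_erase_freqBall {K : ℕ} : ∀ k ∈ (freqBall (d := Fin 3) K).erase 0,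
    -k ∈ (freqBall (d := Fin 3) K).erase 0 := by
  sorry

/-- H1 (bridge, XS): the crux's solution notion is `IsGalerkinODESolution` minus the `rfl` datum. -/
theorem isCoeffTrajectory_iff {S : Finset ℤ³} {ν : ℝ} {g : ℤ³ → ℂ³} {c : ℝ → ↥S → ℂ³} :
    IsCoeffTrajectory S ν g c ↔ IsGalerkinODESolution ν (fun k : ↥S => g k) (c 0) c := by
  sorry

/-- H2 (autonomy, S): time shifts of trajectories are trajectories (`IsGalerkinODESolution.comp_add`). -/
theorem IsCoeffTrajectory.comp_add {S : Finset ℤ³} {ν : ℝ} {g : ℤ³ → ℂ³} {c : ℝ → ↥S → ℂ³}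
    (h : IsCoeffTrajectory S ν g c) {s : ℝ} (hs : 0 ≤ s) :
    IsCoeffTrajectory S ν g (fun t => c (t + s)) := by
  sorry

/-- H3 (slice estimate in LINEAR-DAMPING form, M): on a symmetric `S ∌ 0`, for a real band-limited
`g`, the energy production `2(−ν‖∇u‖² + ∫⟪G,u⟫)` of a Galerkin state is
`≤ −4π²ν·Σ‖c_k‖² + Φ²/(4π²ν)`, `Φ² = Σ_{freqBall N}‖g k‖²` (Poincaré `|k|² ≥ 1` + Cauchy–Schwarz
+ Young `2Φ√e ≤ 4π²ν e + Φ²/(4π²ν)`). Twin of the tree's `energy_deriv_le` (which has `K = +1`). -/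
theorem energy_deriv_le_damped {S : Finset ℤ³} (hS : ∀ k ∈ S, -k ∈ S) (h0 : (0 : ℤ³) ∉ S)
    {ν : ℝ} (hν : 0 < ν) {N : ℕ} {g : ℤ³ → ℂ³} (hg : IsConjSymm g)
    (hsupp : ∀ k, k ∉ freqBall N → g k = 0) {c : ↥S → ℂ³} (hc : c ∈ galerkinSubspace S) :
    2 * (-(ν * (eGradNormSq (realTrigPoly S (coeffExt S c))).toReal) +
        ∫ x, ⟪realTrigPoly S (coeffExt S (fun k : ↥S => g k)) x,
          realTrigPoly S (coeffExt S c) x⟫_ℝ) ≤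
      -(4 * Real.pi ^ 2 * ν) * (∑ k, ‖c k‖ ^ 2) +
        (∑ k ∈ freqBall N, ‖g k‖ ^ 2) / (4 * Real.pi ^ 2 * ν) := by
  sorry

/-- H4 (closed-form absorption, M): along a trajectory on a symmetric `S ∌ 0`,
`e(t) ≤ e(0)·exp(−4π²ν t) + Φ²/(16π⁴ν²)` for all `t ≥ 0` — Mathlib
`le_gronwallBound_of_liminf_deriv_right_le` with `K = −4π²ν`, fed by `hasDerivWithinAt_energy` + H3
(playbook T11), then `gronwallBound δ (−λ) C t = δe^{−λt} + (C/λ)(1 − e^{−λt})`. -/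
theorem modalEnergy_le_exp_decay {S : Finset ℤ³} (hS : ∀ k ∈ S, -k ∈ S) (h0 : (0 : ℤ³) ∉ S)
    {ν : ℝ} (hν : 0 < ν) {N : ℕ} {g : ℤ³ → ℂ³} (hg : IsConjSymm g)
    (hsupp : ∀ k, k ∉ freqBall N → g k = 0) {c : ℝ → ↥S → ℂ³} (hc : IsCoeffTrajectory S ν g c)
    {t : ℝ} (ht : 0 ≤ t) :
    modalEnergy (c t) ≤ modalEnergy (c 0) * Real.exp (-(4 * Real.pi ^ 2 * ν) * t) +
      (∑ k ∈ freqBall N, ‖g k‖ ^ 2) / (4 * Real.pi ^ 2 * ν) ^ 2 := by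
  sorry

/-- H5 (duality, S): for `0 ≤ φ ≤ C` on `(0, ∞)`, locally integrable on `[0, ∞)`,
`liminf` of the running means is `C −` the `limsup` of the running means of `C − φ`
(`timeMean (C − φ) T = C − timeMean φ T` for `T > 0`; `Antitone.map_limsSup_of_continuousAt`
with `x ↦ C − x`; the means live in `[0, C]`, so all (co)boundedness side conditions hold). -/
theorem longTimeAvgInf_eq_const_sub {φ : ℝ → ℝ} {C : ℝ} (h0 : ∀ t, 0 < t → 0 ≤ φ t)
    (hC : ∀ t, 0 < t → φ t ≤ C) (hint : ∀ T, 0 ≤ T → IntervalIntegrable φ volume 0 T) :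
    longTimeAvgInf φ = C - longTimeAvgSup (fun t => C - φ t) := by
  sorry

/-- H6 (the `liminf` twin of `longTimeAvgSup_comp_add_right`, S given H5): for `φ` with
`0 ≤ φ ≤ C` on `[0, ∞)` and locally integrable there, `⟨φ(·+s)⟩⁻ = ⟨φ⟩⁻` for `s ≥ 0`
(H5 twice + the tree's `longTimeAvgSup_comp_add_right` applied to the clamped nonnegative
function `t ↦ C − min (max (φ t) 0) C` + `longTimeAvgSup_congr_of_eqOn_Ioi`). -/
theorem longTimeAvgInf_comp_add_right_of_bounded {φ : ℝ → ℝ} {s C : ℝ}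
    (h0 : ∀ t, 0 ≤ t → 0 ≤ φ t) (hC : ∀ t, 0 ≤ t → φ t ≤ C) (hs : 0 ≤ s)
    (hint : ∀ a b, 0 ≤ a → a ≤ b → IntervalIntegrable φ volume a b) :
    longTimeAvgInf (fun t => φ (t + s)) = longTimeAvgInf φ := by
  sorry

/-! ### §2 PLAN B helpers (regime split ENTRY | INVARIANCE, integrated form) -/

/-- H7 (barrier invariance on `S ∌ 0`, M): port of the private
`MomentParityQuarticTightness.sum_norm_sq_le_of_barrier` with the mean-mode clause replaced by
`0 ∉ S` (Poincaré is then automatic). -/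
theorem modalEnergy_le_of_barrier {S : Finset ℤ³} (hS : ∀ k ∈ S, -k ∈ S) (h0 : (0 : ℤ³) ∉ S)
    {ν : ℝ} (hν : 0 < ν) {g c₀ : ↥S → ℂ³} {α : ℝ → ↥S → ℂ³} (hg : IsRealCoeff g)
    (hsol : IsGalerkinODESolution ν g c₀ α) {Φ R : ℝ} (hΦ0 : 0 ≤ Φ)
    (hgΦ : ∑ k, ‖g k‖ ^ 2 ≤ Φ ^ 2) (hΦR : Φ ≤ 4 * Real.pi ^ 2 * ν * R)
    (hc₀R : ∑ k, ‖c₀ k‖ ^ 2 ≤ R ^ 2) {t : ℝ} (ht : 0 ≤ t) :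
    ∑ k, ‖α t k‖ ^ 2 ≤ R ^ 2 := by
  sorry

/-- H8 (entry by the INTEGRATED energy inequality + mean-value selection, M): some instant in
`[0, e(0)/(4π²ν) + 1]` has energy `≤ Φ²/(16π⁴ν²) + 1` (`galerkin_energy_identity` + H3 integrated
gives `T⁻¹∫₀ᵀ e ≤ e(0)/(4π²νT) + Φ²/(16π⁴ν²)`; `exists_le_setAverage` / first mean value thm). -/
theorem exists_modalEnergy_le_entry {S : Finset ℤ³} (hS : ∀ k ∈ S, -k ∈ S) (h0 : (0 : ℤ³) ∉ S)
    {ν : ℝ} (hν : 0 < ν) {N : ℕ} {g : ℤ³ → ℂ³} (hg : IsConjSymm g)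
    (hsupp : ∀ k, k ∉ freqBall N → g k = 0) {c : ℝ → ↥S → ℂ³} (hc : IsCoeffTrajectory S ν g c) :
    ∃ t₀ ∈ Icc (0 : ℝ) (modalEnergy (c 0) / (4 * Real.pi ^ 2 * ν) + 1),
      modalEnergy (c t₀) ≤ (∑ k ∈ freqBall N, ‖g k‖ ^ 2) / (4 * Real.pi ^ 2 * ν) ^ 2 + 1 := by
  sorry

/-! ### §3 PLAN C helper (one-directional `liminf` shift by ε-slack, fallback for H5/H6) -/

/-- H9 (S): only the direction the stub needs, by `timeMean_comp_add_right`,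
`eventually_lt_of_lt_liminf`, `le_liminf_of_le` (pattern: tree
`le_liminf_timeMean_of_eventually_le`). -/
theorem le_longTimeAvgInf_comp_add_right {φ : ℝ → ℝ} {s C a : ℝ}
    (h0 : ∀ t, 0 ≤ t → 0 ≤ φ t) (hC : ∀ t, 0 ≤ t → φ t ≤ C) (hs : 0 ≤ s)
    (hint : ∀ a b, 0 ≤ a → a ≤ b → IntervalIntegrable φ volume a b)
    (ha : a ≤ longTimeAvgInf φ) : a ≤ longTimeAvgInf (fun t => φ (t + s)) := by
  sorry

/-! ### §4 Assembly check: PLAN A helpers ⇒ the stub (real proof modulo H0–H6) -/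

theorem resolvedDissipation_nonneg {S : Finset ℤ³} {ν : ℝ} (hν : 0 ≤ ν) (M : ℕ) (a : ↥S → ℂ³) :
    0 ≤ resolvedDissipation ν M a := by
  unfold resolvedDissipation
  refine mul_nonneg hν (mul_nonneg (by positivity) (Finset.sum_nonneg fun k _ => ?_))
  split_ifs
  · exact mul_nonneg (Finset.sum_nonneg fun i _ => sq_nonneg _) (sq_nonneg _)
  · exact le_rfl

theorem resolvedDissipation_le {S : Finset ℤ³} {ν : ℝ} (hν : 0 ≤ ν) (M : ℕ) (a : ↥S → ℂ³) :
    resolvedDissipation ν M a ≤ ν * (4 * Real.pi ^ 2 * (M : ℝ) ^ 2) * modalEnergy a := by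
  have h1 : (∑ k : ↥S, (if freqNormSq (k : ℤ³) ≤ (M : ℝ) ^ 2 then
      freqNormSq (k : ℤ³) * ‖a k‖ ^ 2 else 0)) ≤ (M : ℝ) ^ 2 * modalEnergy a := by
    unfold modalEnergy
    rw [Finset.mul_sum]
    refine Finset.sum_le_sum fun k _ => ?_
    split_ifs with h
    · exact mul_le_mul_of_nonneg_right h (sq_nonneg _)
    · positivity
  calc resolvedDissipation ν M a
      = ν * (4 * Real.pi ^ 2 * ∑ k : ↥S, (if freqNormSq (k : ℤ³) ≤ (M : ℝ) ^ 2 then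
          freqNormSq (k : ℤ³) * ‖a k‖ ^ 2 else 0)) := rfl
    _ ≤ ν * (4 * Real.pi ^ 2 * ((M : ℝ) ^ 2 * modalEnergy a)) := by gcongr
    _ = ν * (4 * Real.pi ^ 2 * (M : ℝ) ^ 2) * modalEnergy a := by ring

theorem stub_absorbedWitness_of_planA : Sig.stub_absorbedWitness := by
  intro ν hν N g hcs hsupp _hg0 _htr
  set Φ2 : ℝ := ∑ k ∈ freqBall N, ‖g k‖ ^ 2 with hΦ2
  set B₀ : ℝ := Φ2 / (4 * Real.pi ^ 2 * ν) ^ 2 with hB₀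
  refine ⟨B₀ + 1, fun E ε M K S hS hprem => ?_⟩
  obtain ⟨c, hc, hsup, hinf⟩ := hprem
  have hsym : ∀ k ∈ S, -k ∈ S := by subst hS; exact neg_mem_erase_freqBall
  have h0 : (0 : ℤ³) ∉ S := by subst hS; simp
  -- the shift that makes the transient invisible: `e(0)·exp(−λ s) ≤ 1`
  set lam : ℝ := 4 * Real.pi ^ 2 * ν with hlam
  have hlam0 : 0 < lam := by positivity
  set e0 : ℝ := modalEnergy (c 0) with he0
  have he0nn : 0 ≤ e0 := Finset.sum_nonneg fun k _ => sq_nonneg _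
  set s : ℝ := Real.log (1 + e0) / lam with hsdef
  have hs : 0 ≤ s := div_nonneg (Real.log_nonneg (by linarith)) hlam0.le
  have hdecay : ∀ t, 0 ≤ t → modalEnergy (c (t + s)) ≤ B₀ + 1 := by
    intro t ht
    have h1 := modalEnergy_le_exp_decay hsym h0 hν hcs hsupp hc (t := t + s) (by linarith)
    have h2 : e0 * Real.exp (-lam * (t + s)) ≤ 1 := by
      have h3 : Real.exp (-lam * (t + s)) ≤ Real.exp (-lam * s) :=
        Real.exp_le_exp.2 (by nlinarith)
      have h4 : Real.exp (-lam * s) = (1 + e0)⁻¹ := by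
        rw [hsdef, show -lam * (Real.log (1 + e0) / lam) = -Real.log (1 + e0) by field_simp,
          Real.exp_neg, Real.exp_log (by linarith)]
      calc e0 * Real.exp (-lam * (t + s)) ≤ e0 * Real.exp (-lam * s) :=
            mul_le_mul_of_nonneg_left h3 he0nn
        _ = e0 * (1 + e0)⁻¹ := by rw [h4]
        _ ≤ 1 := by rw [← div_eq_mul_inv, div_le_one (by linarith)]; linarith
    have h1' : modalEnergy (c (t + s)) ≤ e0 * Real.exp (-lam * (t + s)) + B₀ := h1
    linarith
  -- boundedness of both observables on `[0, ∞)` along the ORIGINAL trajectory (no junk limsup/liminf)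
  have hbd : ∀ t, 0 ≤ t → modalEnergy (c t) ≤ e0 + B₀ := by
    intro t ht
    have h1 := modalEnergy_le_exp_decay hsym h0 hν hcs hsupp hc ht
    have h2 : e0 * Real.exp (-(4 * Real.pi ^ 2 * ν) * t) ≤ e0 :=
      mul_le_of_le_one_right he0nn (Real.exp_le_one_iff.2 (by nlinarith [hlam0]))
    have h1' : modalEnergy (c t) ≤ e0 * Real.exp (-(4 * Real.pi ^ 2 * ν) * t) + B₀ := h1
    linarith
  refine ⟨fun t => c (t + s), hc.comp_add hs, hdecay, ?_, ?_⟩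
  · -- limsup side: the tree's shift invariance, verbatim
    have hint : ∀ a b, 0 ≤ a → a ≤ b →
        IntervalIntegrable (fun t => modalEnergy (c t)) volume a b := by
      intro a b ha hab
      refine ContinuousOn.intervalIntegrable ?_
      rw [uIcc_of_le hab]
      have hcont : ContinuousOn c (Icc a b) := hc.2.1.mono fun t ht => ha.trans ht.1
      unfold modalEnergy
      exact continuousOn_finsetSum _ fun k _ =>
        ((continuous_apply k).comp_continuousOn hcont).norm.pow 2
    have := longTimeAvgSup_comp_add_right (φ := fun t => modalEnergy (c t))
      (fun t => Finset.sum_nonneg fun k _ => sq_nonneg _) hs hint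
    rw [this]
    exact hsup
  · -- liminf side: H6 with `C = ν·4π²M²·(e0 + B₀)`
    have hint : ∀ a b, 0 ≤ a → a ≤ b →
        IntervalIntegrable (fun t => resolvedDissipation ν M (c t)) volume a b := by
      intro a b ha hab
      refine ContinuousOn.intervalIntegrable ?_
      rw [uIcc_of_le hab]
      have hcont : ContinuousOn c (Icc a b) := hc.2.1.mono fun t ht => ha.trans ht.1
      unfold resolvedDissipation
      refine continuousOn_const.mul (continuousOn_const.mul (continuousOn_finsetSum _ fun k _ => ?_))
      split_ifs
      · exact continuousOn_const.mul (((continuous_apply k).comp_continuousOn hcont).norm.pow 2)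
      · exact continuousOn_const
    have := longTimeAvgInf_comp_add_right_of_bounded (φ := fun t => resolvedDissipation ν M (c t))
      (C := ν * (4 * Real.pi ^ 2 * (M : ℝ) ^ 2) * (e0 + B₀))
      (fun t _ => resolvedDissipation_nonneg hν.le M (c t))
      (fun t ht => (resolvedDissipation_le hν.le M (c t)).trans
        (mul_le_mul_of_nonneg_left (hbd t ht) (by positivity))) hs hint
    rw [this]
    exact hinf

end Summit.AnomalousDissipation.AnomalousDissipation.Cruxes.UniformEquilibration.StubIdeas2

end
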